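import Mathlib.RingTheory.NoetherNormalization
import Mathlib.FieldTheory.Minpoly.IsIntegrallyClosed
import Mathlib.FieldTheory.IsAlgClosed.Basic
import Mathlib.RingTheory.Ideal.GoingUp
import Mathlib.RingTheory.Polynomial.UniqueFactorization
import Mathlib.Algebra.GCDMonoid.IntegrallyClosed
import Mathlib.Algebra.Module.Submodule.Union
import Mathlib.Algebra.MvPolynomial.Funext
import Mathlib.Analysis.Normed.Field.Approximation
import Mathlib.Analysis.Polynomial.CauchyBound
import Mathlib.Analysis.Complex.Polynomial.Basic
import Mathlib.Analysis.Analytic.Polynomial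
import Mathlib.Topology.Algebra.MvPolynomial
import Literature.NumberTheory.Transcendental.AnalytificationProper
import Literature.AlgebraicGeometry.Motives.AlgPointsProperProofs
import Literature.AlgebraicGeometry.Motives.AlgPointsProductProofs
import Literature.AlgebraicGeometry.Morphisms.UniversallyClosedLimitProofs
import HarnessLib

/-!
# `X(ℂ)` compact ⇔ `X` proper: discharge of the named fact (proof file)

Sibling proof file of `Literature/NumberTheory/Transcendental/Analytification.lean` and
`AnalytificationProper.lean`. The former vendors the named fact
`Literature.ComplexPoints.compactSpace_iff_isProper X`: for a scheme `X` separated and locally of finite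
type over a subfield `k ⊆ ℂ`, `X(ℂ)` with its strong topology is compact iff `X → Spec k` is
proper [Serre, GAGA §2 n°7 Prop. 6; SGA1 XII Prop. 3.2 (v)]. The latter reduces it
(`Literature.AlgebraicGeometry.Motives.ComplexPoints.compactSpace_iff_isProper_of`) to four named facts, three of which are
discharged elsewhere in the tree:

* `Literature.AlgebraicGeometry.Motives.compactSpace_algPoints_of_isProper_holds` (`Motives/AlgPointsProperProofs.lean`),
* `Literature.AlgebraicGeometry.Motives.AlgPoints.isHomeomorph_prodEquiv_holds` (`Motives/AlgPointsProductProofs.lean`),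
* `Literature.AlgebraicGeometry.Morphisms.universallyClosed_iff_isClosedMap_affineSpaceMap_holds`
  (`Morphisms/UniversallyClosedLimitProofs.lean`, Stacks 05JX).

This file discharges the fourth, `Literature.ComplexPoints.closure_setOf_pt_mem (affineSpaceOver σ k)`
(SGA1 XII Prop. 2.2 for affine space: Zariski closures of constructible subsets of `𝔸^σ_k` are
detected on complex points), and assembles
**`Literature.ComplexPoints.compactSpace_iff_isProper_holds : compactSpace_iff_isProper X`**.

## The proof of SGA1 XII Prop. 2.2 for `𝔸^σ_k`

SGA1's printed proof uses the analytic local rings (`Ô_{X,x} ≅ Ô_{X^an,x}` and Rückert's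
Nullstellensatz), which are not available. We give an elementary proof. By the induction
principle for constructible sets and the decomposition of closed sets of the Noetherian space
`Spec k[X_σ]` into irreducible components (`AlgHomClosure.closure_preimage_eq_of_isConstructible`)
it suffices to show: for a prime `𝔭 ⊆ k[X_σ]`, `f ∉ 𝔭` and a complex zero `w₀` of `𝔭`, the complex
zeros `w` of `𝔭` with `f(w) ≠ 0` accumulate at `w₀` (`AlgHomClosure.mem_closure_setOf_le_ker_aeval`).
In terms of the domain `A = k[X_σ]/𝔭` (`AlgHomClosure.coe_mem_closure_image_coe_setOf_apply_ne_zero`):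
a `k`-algebra homomorphism `ψ₀ : A → ℂ` is a pointwise limit of homomorphisms `ψ` with `ψ(a) ≠ 0`
(`a ≠ 0` given). Proof:

1. Noether normalisation `R = k[Y₁,…,Y_d] ↪ A` (Mathlib), `A` integral over `R`; `a` satisfies a
   monic equation over `R` with constant term `c₀ ≠ 0`, so `ψ(c₀) ≠ 0 ⇒ ψ(a) ≠ 0`, and
   `{t ∈ ℂᵈ | c₀(t) ≠ 0}` is dense (identity principle).
2. The fibre `F` of `ψ ↦ ψ|_R` through `ψ₀` is finite; as `k` is infinite some `y ∈ A` separates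
   its points (a vector space over an infinite field is not a finite union of proper subspaces).
3. Let `G = minpoly_R(y)` (`R` is integrally closed). By continuity of roots (Mathlib
   `Polynomial.exists_roots_norm_sub_lt_of_norm_coeff_sub_lt`) the specialisation `G_t` has a
   root `u(t) → ψ₀(y)` as `t → t₀ = ψ₀|_R`.
4. `(t, u(t))` defines a ring map `R[y] ≅ R[Y]/(G) → ℂ`, which extends to `ψ_t : A → ℂ` (lying
   over + `IsAlgClosed.lift`, `AlgHomClosure.exists_ringHom_comp_eq_of_isIntegral`).
5. The values `ψ_t(x)` are bounded for `t` near `t₀` (Cauchy bound for the monic equation of `x`),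
   so by Tychonoff every cluster point of `ψ_t` in `ℂ^A` is a homomorphism in `F` taking the
   value `ψ₀(y)` at `y`, hence equals `ψ₀`: `ψ_t → ψ₀`, with `ψ_t(a) ≠ 0` for `c₀(t) ≠ 0`.

The passage to `𝔸^σ_k(ℂ)` uses the homeomorphism `𝔸^σ_k(ℂ) ≃ₜ ℂ^σ` (coordinates; continuity of its
inverse for general `k ⊆ ℂ` is `ComplexPoints.continuous_affinePoint_of_algebra`) and
`𝔸^σ_k ≅ Spec k[X_σ]`, under which `P.pt` is the kernel of evaluation at the coordinates of `P`
(`ComplexPoints.specIso_hom_apply_pt`).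

## References

* A. Grothendieck, M. Raynaud, *SGA 1*, Exposé XII, Prop. 2.2, Prop. 3.2 (v). [SGA1]
* J.-P. Serre, *Géométrie algébrique et géométrie analytique*, Ann. Inst. Fourier **6** (1956),
  §2 n°7, Prop. 5 and Prop. 6. [SerreGAGA1956]
* M. F. Atiyah, I. G. Macdonald, *Introduction to Commutative Algebra*, Ch. 5 (integral
  extensions, lying over). [folklore]
-/

noncomputable section

open Polynomial Filter Topology

namespace Literature.NumberTheory.Transcendental

namespace AlgHomClosure

/-! ### Extension of ring homomorphisms to an algebraically closed field along integral maps -/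

/-- **Homomorphisms to an algebraically closed field extend along integral ring maps.** If
`j : A → B` is an integral ring homomorphism and `φ : A → M` is a ring homomorphism to an
algebraically closed field killing `ker j`, then `φ = Φ ∘ j` for some `Φ : B → M`: lying over
(`Ideal.exists_ideal_over_prime_of_isIntegral`) for the prime `ker φ`, then extension of the
injective map `A/𝔭 → M` to the algebraic extension `B/𝔔 ⊇ A/𝔭` (`IsAlgClosed.lift`).
[Atiyah–Macdonald, Thm. 5.10 (lying over) and Ch. 5 Ex. 2] [folklore] -/
theorem exists_ringHom_comp_eq_of_isIntegral {A B M : Type*} [CommRing A] [CommRing B] [Field M]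
    [IsAlgClosed M] (j : A →+* B) (hj : j.IsIntegral) (φ : A →+* M)
    (hker : RingHom.ker j ≤ RingHom.ker φ) : ∃ Φ : B →+* M, Φ.comp j = φ := by
  letI : Algebra A B := j.toAlgebra
  haveI : Algebra.IsIntegral A B := ⟨fun x ↦ hj x⟩
  haveI : (RingHom.ker φ).IsPrime := RingHom.ker_isPrime φ
  obtain ⟨Q, -, hQ, hQP⟩ := Ideal.exists_ideal_over_prime_of_isIntegral (RingHom.ker φ)
    (⊥ : Ideal B) (by rw [← RingHom.ker_eq_comap_bot]; exact hker)
  -- the induced maps `A ⧸ 𝔭 → B ⧸ 𝔔` (injective, integral) and `A ⧸ 𝔭 → M` (injective)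
  haveI : Q.IsPrime := hQ
  set P : Ideal A := Q.comap (algebraMap A B) with hPdef
  haveI : P.IsPrime := by rw [hPdef]; exact Ideal.comap_isPrime _ Q
  have hmem : ∀ a : A, a ∈ P → φ a = 0 := fun a ha ↦ by
    rw [hQP] at ha
    exact ha
  let φ' : A ⧸ P →+* M := Ideal.Quotient.lift P φ hmem
  have hφ' : Function.Injective φ' := RingHom.lift_injective_of_ker_le_ideal P hmem hQP.ge
  letI : Algebra (A ⧸ P) M := φ'.toAlgebra
  haveI : Module.IsTorsionFree (A ⧸ P) M :=
    Module.isTorsionFree_iff_algebraMap_injective.mpr hφ'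
  haveI : Module.IsTorsionFree (A ⧸ P) (B ⧸ Q) :=
    Module.isTorsionFree_iff_algebraMap_injective.mpr Ideal.algebraMap_quotient_injective
  haveI : Algebra.IsAlgebraic (A ⧸ P) (B ⧸ Q) := Algebra.IsIntegral.isAlgebraic
  let Φ' : (B ⧸ Q) →ₐ[A ⧸ P] M := IsAlgClosed.lift
  refine ⟨Φ'.toRingHom.comp (Ideal.Quotient.mk Q), RingHom.ext fun a ↦ ?_⟩
  have h1 : Ideal.Quotient.mk Q (j a) = algebraMap (A ⧸ P) (B ⧸ Q) (Ideal.Quotient.mk P a) := rfl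
  rw [RingHom.comp_apply, RingHom.comp_apply, AlgHom.toRingHom_eq_coe, AlgHom.coe_toRingHom, h1,
    AlgHom.commutes]
  change φ' (Ideal.Quotient.mk P a) = φ a
  exact Ideal.Quotient.lift_mk P φ hmem

/-! ### A monic relation with non-zero constant term -/

/-- A non-zero element `a` of a domain, integral over `R` (via `i : R → A`), satisfies a monic
equation over `R` with **non-zero constant coefficient**: divide a monic relation by the largest
power of the variable. Consequently `χ(a) = 0 ⇒ χ(i(c₀)) = 0` for every ring homomorphism `χ`
on `A`, with `c₀ ≠ 0` that constant coefficient. [Atiyah–Macdonald, proof of Prop. 5.7]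
[folklore] -/
theorem exists_monic_eval₂_eq_zero_coeff_zero_ne_zero {R A : Type*} [CommRing R] [CommRing A]
    [IsDomain A] (i : R →+* A) {a : A} (ha : a ≠ 0) (hint : i.IsIntegralElem a) :
    ∃ p : R[X], p.Monic ∧ p.eval₂ i a = 0 ∧ p.coeff 0 ≠ 0 := by
  haveI : Nontrivial R := i.domain_nontrivial
  obtain ⟨p, hp, hpa⟩ := hint
  induction hn : p.natDegree using Nat.strong_induction_on generalizing p with
  | _ n ih =>
    by_cases h0 : p.coeff 0 = 0
    · obtain ⟨q, rfl⟩ := Polynomial.X_dvd_iff.mpr h0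
      have hq : q.Monic := monic_X.of_mul_monic_left hp
      have hqa : q.eval₂ i a = 0 := by
        rw [eval₂_mul, eval₂_X] at hpa
        exact (mul_eq_zero.mp hpa).resolve_left ha
      have hlt : q.natDegree < n := by
        rw [← hn, natDegree_X_mul hq.ne_zero]
        exact Nat.lt_succ_self _
      exact ih _ hlt q hq hqa rfl
    · exact ⟨p, hp, hpa, h0⟩

/-! ### Homomorphisms as a closed subset of the function space -/

section Closed

variable {k A B : Type*} [CommSemiring k] [Semiring A] [Algebra k A] [Semiring B] [Algebra k B]
  [TopologicalSpace B] [T2Space B] [ContinuousAdd B] [ContinuousMul B] [ContinuousConstSMul k B]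

/-- **The `k`-algebra homomorphisms `A → B` form a closed subset of `B^A`** (pointwise
topology, `B` a Hausdorff topological `k`-algebra): being a homomorphism is a family of closed
equational conditions on the values. [Bourbaki, TG X §3] [folklore] -/
theorem isClosed_range_coe :
    IsClosed (Set.range fun ψ : A →ₐ[k] B ↦ (⇑ψ : A → B)) := by
  have hrange : (Set.range fun ψ : A →ₐ[k] B ↦ (⇑ψ : A → B)) =
      {φ | φ 1 = 1} ∩ (⋂ x, ⋂ y, {φ | φ (x * y) = φ x * φ y}) ∩
        (⋂ x, ⋂ y, {φ | φ (x + y) = φ x + φ y}) ∩ (⋂ (c : k), ⋂ x, {φ | φ (c • x) = c • φ x}) := by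
    ext φ
    simp only [Set.mem_range, Set.mem_inter_iff, Set.mem_setOf_eq, Set.mem_iInter]
    constructor
    · rintro ⟨ψ, rfl⟩
      exact ⟨⟨⟨map_one ψ, fun x y ↦ map_mul ψ x y⟩, fun x y ↦ map_add ψ x y⟩,
        fun c x ↦ map_smul ψ c x⟩
    · rintro ⟨⟨⟨h1, hmul⟩, hadd⟩, hsmul⟩
      let f : A →ₗ[k] B := { toFun := φ, map_add' := hadd, map_smul' := hsmul }
      exact ⟨AlgHom.ofLinearMap f h1 hmul, rfl⟩
  rw [hrange]
  refine ((IsClosed.inter ?_ ?_).inter ?_).inter ?_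
  · exact isClosed_eq (continuous_apply 1) continuous_const
  · exact isClosed_iInter fun x ↦ isClosed_iInter fun y ↦
      isClosed_eq (continuous_apply _) ((continuous_apply x).mul (continuous_apply y))
  · exact isClosed_iInter fun x ↦ isClosed_iInter fun y ↦
      isClosed_eq (continuous_apply _) ((continuous_apply x).add (continuous_apply y))
  · exact isClosed_iInter fun c ↦ isClosed_iInter fun x ↦
      isClosed_eq (continuous_apply _) ((continuous_apply x).const_smul c)

end Closed

/-! ### Values at cluster points -/

/-- If `g ∘ Ψ → c` along `l` and `φ` is a cluster point of `Ψ` along `l`, then `g φ = c` for `g`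
continuous at `φ` (Hausdorff target). [Bourbaki, TG I §7] [folklore] -/
theorem apply_eq_of_mapClusterPt {X Y ι : Type*} [TopologicalSpace X]
    [TopologicalSpace Y] [T2Space Y] {φ : X} {l : Filter ι} {Ψ : ι → X} (h : MapClusterPt φ l Ψ)
    {g : X → Y} (hg : ContinuousAt g φ) {c : Y} (hc : Tendsto (g ∘ Ψ) l (𝓝 c)) : g φ = c :=
  t2_iff_nhds.mp ‹T2Space Y› (ClusterPt.map h.clusterPt hg (tendsto_map'_iff.mpr hc))

/-! ### Polynomials: density of `{c ≠ 0}` and a root bound -/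

/-- **A non-zero polynomial over `k ⊆ ℂ` is non-zero on a dense subset of `ℂᵈ`**: its zero set
is closed with empty interior (a polynomial vanishing on a non-empty open subset of `ℂᵈ`
vanishes identically, by the identity principle for the analytic function `t ↦ c(t)`).
This is Serre's GAGA Prop. 5 for `X = ℂᵈ` and the Z-open `{c ≠ 0}`. [folklore] -/
theorem dense_setOf_aeval_ne_zero {k : Type*} [Field k] [Algebra k ℂ] {d : ℕ}
    {c : MvPolynomial (Fin d) k} (hc : c ≠ 0) :
    Dense {t : Fin d → ℂ | MvPolynomial.aeval t c ≠ 0} := by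
  set c' : MvPolynomial (Fin d) ℂ := MvPolynomial.map (algebraMap k ℂ) c with hc'def
  have hc' : c' ≠ 0 := fun h ↦ hc (MvPolynomial.map_injective _ (algebraMap k ℂ).injective
    (by rw [← hc'def, h, map_zero]))
  have heval : ∀ t : Fin d → ℂ, MvPolynomial.aeval t c = MvPolynomial.eval t c' := fun t ↦ by
    rw [hc'def, MvPolynomial.eval_map, MvPolynomial.aeval_def]
  have hset : {t : Fin d → ℂ | MvPolynomial.aeval t c ≠ 0} = {t | MvPolynomial.eval t c' = 0}ᶜ := by
    ext t; simp [heval]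
  rw [hset, ← interior_eq_empty_iff_dense_compl, Set.eq_empty_iff_forall_notMem]
  intro z hz
  apply hc'
  have hanal := AnalyticOnNhd.eval_mvPolynomial c'
  have hzero : (fun t : Fin d → ℂ ↦ MvPolynomial.eval t c') =ᶠ[𝓝 z] 0 :=
    Filter.eventually_of_mem (mem_interior_iff_mem_nhds.mp hz) fun t ht ↦ ht
  have hall := hanal.eqOn_zero_of_preconnected_of_eventuallyEq_zero isPreconnected_univ
    (Set.mem_univ z) hzero
  exact MvPolynomial.funext fun t ↦ by simpa using hall (Set.mem_univ t)

/-- Roots of a monic polynomial whose lower coefficients have norm `≤ M` have norm `≤ M + 1`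
(Cauchy's bound, Mathlib `Polynomial.IsRoot.norm_lt_cauchyBound`). [folklore] -/
theorem norm_le_of_isRoot_of_monic {K : Type*} [NormedField K] {p : K[X]} (hp : p.Monic) {M : ℝ}
    (hM0 : 0 ≤ M) (hM : ∀ i < p.natDegree, ‖p.coeff i‖ ≤ M) {z : K} (hz : p.IsRoot z) :
    ‖z‖ ≤ M + 1 := by
  have h1 := hz.norm_lt_cauchyBound hp.ne_zero
  have h2 : cauchyBound p ≤ M.toNNReal + 1 := by
    unfold cauchyBound
    rw [hp.leadingCoeff, nnnorm_one, div_one]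
    refine add_le_add (Finset.sup_le fun i hi ↦ ?_) le_rfl
    rw [← NNReal.coe_le_coe, coe_nnnorm, Real.coe_toNNReal _ hM0]
    exact hM i (Finset.mem_range.mp hi)
  have h3 : (‖z‖₊ : ℝ) ≤ (M.toNNReal + 1 : NNReal) := by exact_mod_cast (h1.le.trans h2)
  simpa [Real.coe_toNNReal _ hM0] using h3

/-! ### The density theorem -/

/-- **Core density theorem.** Let `A` be a finitely generated domain over a subfield `k ⊆ ℂ`,
`a ∈ A` non-zero and `ψ₀ : A → ℂ` a `k`-algebra homomorphism (a complex point of `Spec A`).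
Then `ψ₀` is a limit, in the topology of pointwise convergence, of complex points `ψ` with
`ψ(a) ≠ 0`; i.e. the complex points of the dense open `D(a) ⊆ Spec A` are dense in the complex
points of `Spec A` for the strong topology. [cite: SGA1, Exp. XII Prop. 2.2]
[cite: SerreGAGA1956, §2 n°7 Prop. 5] -/
theorem coe_mem_closure_image_coe_setOf_apply_ne_zero {k : Type*} [Field k] [Algebra k ℂ]
    {A : Type*} [CommRing A] [IsDomain A] [Algebra k A] [Algebra.FiniteType k A] {a : A}
    (ha : a ≠ 0) (ψ₀ : A →ₐ[k] ℂ) :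
    (⇑ψ₀ : A → ℂ) ∈ closure ((fun ψ : A →ₐ[k] ℂ ↦ (⇑ψ : A → ℂ)) '' {ψ | ψ a ≠ 0}) := by
  classical
  /- Step 1: Noether normalisation `ι : R = k[Y₁, …, Y_d] ↪ A`, `A` integral over `R`. -/
  obtain ⟨d, ι, hιinj, hιint⟩ := exists_integral_inj_algHom_of_fg k A
  haveI hk0 : CharZero k := (RingHom.charZero_iff (algebraMap k ℂ).injective).mpr inferInstance
  letI : Algebra (MvPolynomial (Fin d) k) A := ι.toRingHom.toAlgebra
  have halg : algebraMap (MvPolynomial (Fin d) k) A = ι.toRingHom := rfl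
  haveI : IsScalarTower k (MvPolynomial (Fin d) k) A :=
    IsScalarTower.of_algebraMap_eq fun c ↦ (ι.commutes c).symm
  haveI : Algebra.IsIntegral (MvPolynomial (Fin d) k) A := ⟨fun x ↦ hιint x⟩
  haveI : Module.IsTorsionFree (MvPolynomial (Fin d) k) A :=
    Module.isTorsionFree_iff_algebraMap_injective.mpr hιinj
  -- the evaluations `e t : R → ℂ` at `t ∈ ℂᵈ`; `ψ₀ ∘ ι = e t₀`
  set e : (Fin d → ℂ) → MvPolynomial (Fin d) k →ₐ[k] ℂ := fun t ↦ MvPolynomial.aeval t with he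
  set t₀ : Fin d → ℂ := fun i ↦ ψ₀ (ι (MvPolynomial.X i)) with ht₀
  have he₀ : e t₀ = ψ₀.comp ι := MvPolynomial.algHom_ext fun i ↦ by simp [he, ht₀]
  have he₀' : ∀ r, e t₀ r = ψ₀ (ι r) := fun r ↦ by rw [he₀]; rfl
  have hcont : ∀ r : MvPolynomial (Fin d) k, Continuous fun t ↦ e t r := fun r ↦ by
    have : (fun t ↦ e t r) =
        fun t ↦ MvPolynomial.eval t (MvPolynomial.map (algebraMap k ℂ) r) := by
      ext t; rw [he, MvPolynomial.eval_map, MvPolynomial.aeval_def]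
    rw [this]
    exact MvPolynomial.continuous_eval _
  /- Step 2: `c₀ ∈ R ∖ 0` with `χ(a) = 0 ⇒ χ(ι c₀) = 0`; `{t | c₀(t) ≠ 0}` is dense. -/
  obtain ⟨ν, -, hνa, hν0⟩ :=
    exists_monic_eval₂_eq_zero_coeff_zero_ne_zero ι.toRingHom ha (hιint a)
  have hc₀ : ∀ χ : A →+* ℂ, χ a = 0 → χ (ι (ν.coeff 0)) = 0 := fun χ hχ ↦ by
    have h := congrArg χ hνa
    rw [Polynomial.hom_eval₂, hχ, map_zero, Polynomial.eval₂_at_zero] at h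
    exact h
  have hD : Dense {t : Fin d → ℂ | e t (ν.coeff 0) ≠ 0} := dense_setOf_aeval_ne_zero hν0
  /- Step 3: the fibre `F` of `ψ ↦ ψ ∘ ι` through `ψ₀` is finite; `y` separates its points. -/
  set F : Set (A →ₐ[k] ℂ) := {ψ | ∀ r, ψ (ι r) = ψ₀ (ι r)} with hF
  have hFfin : F.Finite := by
    obtain ⟨s, hs⟩ := Algebra.FiniteType.out (R := k) (A := A)
    have hTx : ∀ x : A, ∃ T : Set ℂ, T.Finite ∧ ∀ ψ ∈ F, ψ x ∈ T := by
      intro x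
      obtain ⟨H, hHm, hHx⟩ := hιint x
      refine ⟨{z | (H.map (e t₀ : MvPolynomial (Fin d) k →+* ℂ)).IsRoot z},
        Polynomial.finite_setOf_isRoot (hHm.map _).ne_zero, fun ψ hψ ↦ ?_⟩
      have h := congrArg (ψ : A →+* ℂ) hHx
      have hcomp : (ψ : A →+* ℂ).comp ι.toRingHom = (e t₀ : MvPolynomial (Fin d) k →+* ℂ) :=
        RingHom.ext fun r ↦ show ψ (ι r) = e t₀ r by rw [he₀' r]; exact hψ r
      rw [Polynomial.hom_eval₂, map_zero, hcomp] at h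
      show (H.map _).IsRoot (ψ x)
      rw [IsRoot, Polynomial.eval_map]
      exact h
    choose T hTfin hT using hTx
    have hmaps : Set.MapsTo (fun (ψ : A →ₐ[k] ℂ) (x : {x // x ∈ s}) ↦ ψ x.1) F
        (Set.pi Set.univ fun x : {x // x ∈ s} ↦ T x.1) := fun ψ hψ x _ ↦ hT x.1 ψ hψ
    have hinj : Set.InjOn (fun (ψ : A →ₐ[k] ℂ) (x : {x // x ∈ s}) ↦ ψ x.1) F := by
      intro ψ _ ψ' _ h
      exact AlgHom.ext_of_adjoin_eq_top hs fun x hx ↦ congrFun h ⟨x, hx⟩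
    exact Set.Finite.of_finite_image
      ((Set.Finite.pi (ι := {x // x ∈ s}) fun x ↦ hTfin x.1).subset (Set.mapsTo_iff_image_subset.mp hmaps)) hinj
  obtain ⟨y, hy⟩ : ∃ y : A, ∀ ψ ∈ F, ∀ ψ' ∈ F, ψ ≠ ψ' → ψ y ≠ ψ' y := by
    haveI : Infinite k := Infinite.of_injective _ Nat.cast_injective
    haveI : Finite F := hFfin.to_subtype
    let V : {p : F × F // p.1 ≠ p.2} → Submodule k A := fun p ↦
      LinearMap.ker ((p.1.1.1 : A →ₐ[k] ℂ).toLinearMap - (p.1.2.1 : A →ₐ[k] ℂ).toLinearMap)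
    have hV : ∀ p, V p ≠ ⊤ := by
      rintro ⟨⟨⟨ψ, hψ⟩, ⟨ψ', hψ'⟩⟩, hne⟩ htop
      refine hne (Subtype.ext (AlgHom.ext fun x ↦ ?_))
      have hx : x ∈ V ⟨(⟨ψ, hψ⟩, ⟨ψ', hψ'⟩), hne⟩ := htop ▸ Submodule.mem_top
      simpa [V, sub_eq_zero] using hx
    obtain ⟨y, hy⟩ := Submodule.exists_forall_notMem_of_forall_ne_top V hV
    refine ⟨y, fun ψ hψ ψ' hψ' hne heq ↦
      hy ⟨(⟨ψ, hψ⟩, ⟨ψ', hψ'⟩), fun h ↦ hne (congrArg Subtype.val h)⟩ ?_⟩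
    simpa [V, sub_eq_zero] using heq
  /- Step 4: `G = minpoly_R(y)`, its specialisations `G_t`, and roots `u t → u₀ = ψ₀ y`. -/
  have hyint : IsIntegral (MvPolynomial (Fin d) k) y := Algebra.IsIntegral.isIntegral y
  set G := minpoly (MvPolynomial (Fin d) k) y with hG
  have hGm : G.Monic := minpoly.monic hyint
  have hN : 0 < G.natDegree := minpoly.natDegree_pos hyint
  set Gt : (Fin d → ℂ) → ℂ[X] := fun t ↦ G.map (e t : MvPolynomial (Fin d) k →+* ℂ) with hGt
  have hGtm : ∀ t, (Gt t).Monic := fun t ↦ hGm.map _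
  have hGtdeg : ∀ t, (Gt t).natDegree = G.natDegree := fun t ↦ hGm.natDegree_map _
  have hGtcoeff : ∀ t i, (Gt t).coeff i = e t (G.coeff i) := fun t i ↦ Polynomial.coeff_map _ _
  have hGteval : ∀ (t) (χ : A →+* ℂ), (∀ r, χ (ι r) = e t r) → (Gt t).eval (χ y) = 0 := by
    intro t χ hχ
    have h := congrArg χ (minpoly.aeval (MvPolynomial (Fin d) k) y)
    have hcomp : χ.comp (algebraMap (MvPolynomial (Fin d) k) A) =
        (e t : MvPolynomial (Fin d) k →+* ℂ) :=
      RingHom.ext fun r ↦ by rw [RingHom.comp_apply, halg]; exact hχ r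
    rw [map_zero, Polynomial.aeval_def, Polynomial.hom_eval₂, hcomp] at h
    rw [hGt, Polynomial.eval_map]
    exact h
  have hu₀ : (Gt t₀).eval (ψ₀ y) = 0 := hGteval t₀ ψ₀ fun r ↦ (he₀' r).symm
  have hroots : ∀ t, (Gt t).roots.toFinset.Nonempty := fun t ↦ by
    have hdeg : (Gt t).degree ≠ 0 := by
      rw [Polynomial.degree_eq_natDegree (hGtm t).ne_zero, hGtdeg t]
      exact_mod_cast hN.ne'
    obtain ⟨z, hz⟩ := IsAlgClosed.exists_root (Gt t) hdeg
    exact ⟨z, Multiset.mem_toFinset.mpr ((mem_roots (hGtm t).ne_zero).mpr hz)⟩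
  choose u hu using fun t ↦ Finset.exists_min_image (Gt t).roots.toFinset (fun b ↦ ‖ψ₀ y - b‖)
    (hroots t)
  have humem : ∀ t, (Gt t).IsRoot (u t) := fun t ↦
    (mem_roots (hGtm t).ne_zero).mp (Multiset.mem_toFinset.mp (hu t).1)
  have hut : Tendsto u (𝓝 t₀) (𝓝 (ψ₀ y)) := by
    rw [Metric.tendsto_nhds]
    intro ε' hε'
    -- a small `ε` for the continuity-of-roots estimate
    obtain ⟨ε, hε, hεsmall⟩ : ∃ ε : ℝ, 0 < ε ∧
        ((G.natDegree + 1 : ℝ) * ε) ^ (G.natDegree : ℝ)⁻¹ * max ‖ψ₀ y‖ 1 < ε' := by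
      have hcts : ContinuousAt
          (fun ε : ℝ ↦ ((G.natDegree + 1 : ℝ) * ε) ^ (G.natDegree : ℝ)⁻¹ * max ‖ψ₀ y‖ 1) 0 := by
        refine ContinuousAt.mul ?_ continuousAt_const
        refine ContinuousAt.comp (g := fun x : ℝ ↦ x ^ (G.natDegree : ℝ)⁻¹) ?_
          (continuous_const.mul continuous_id).continuousAt
        exact Real.continuousAt_rpow_const _ _ (Or.inr (by positivity))
      have h0 : ((G.natDegree + 1 : ℝ) * 0) ^ (G.natDegree : ℝ)⁻¹ * max ‖ψ₀ y‖ 1 < ε' := by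
        rw [mul_zero, Real.zero_rpow (by positivity), zero_mul]
        exact hε'
      have hev : ∀ᶠ ε in 𝓝[>] (0 : ℝ),
          ((G.natDegree + 1 : ℝ) * ε) ^ (G.natDegree : ℝ)⁻¹ * max ‖ψ₀ y‖ 1 < ε' ∧ 0 < ε :=
        ((hcts.eventually (gt_mem_nhds h0)).filter_mono nhdsWithin_le_nhds).and
          self_mem_nhdsWithin
      obtain ⟨ε, h1, h2⟩ := hev.exists
      exact ⟨ε, h2, h1⟩
    -- the coefficients of `G_t` are close to those of `G_{t₀}` for `t` near `t₀`
    have hcoef : ∀ᶠ t in 𝓝 t₀, ∀ i, ‖(Gt t).coeff i - (Gt t₀).coeff i‖ < ε := by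
      have h1 : ∀ i, ∀ᶠ t in 𝓝 t₀, ‖(Gt t).coeff i - (Gt t₀).coeff i‖ < ε := fun i ↦ by
        simp only [hGtcoeff]
        have h := Metric.tendsto_nhds.mp ((hcont (G.coeff i)).tendsto t₀) ε hε
        exact h.mono fun t ht ↦ by rwa [← dist_eq_norm]
      have h2 : ∀ᶠ t in 𝓝 t₀, ∀ i ∈ Finset.range (G.natDegree + 1),
          ‖(Gt t).coeff i - (Gt t₀).coeff i‖ < ε :=
        (Filter.eventually_all_finset _).mpr fun i _ ↦ h1 i
      filter_upwards [h2] with t ht i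
      by_cases hi : i < G.natDegree + 1
      · exact ht i (Finset.mem_range.mpr hi)
      · have hi' : G.natDegree < i := by omega
        rw [Polynomial.coeff_eq_zero_of_natDegree_lt (by rw [hGtdeg]; exact hi'),
          Polynomial.coeff_eq_zero_of_natDegree_lt (by rw [hGtdeg]; exact hi'), sub_zero, norm_zero]
        exact hε
    filter_upwards [hcoef] with t ht
    obtain ⟨b, hb, hbub⟩ := Polynomial.exists_roots_norm_sub_lt_of_norm_coeff_sub_lt hε hu₀
      (hGtm t₀) (hGtm t) (by rw [hGtdeg, hGtdeg]) ht (IsAlgClosed.splits _)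
    rw [hGtdeg] at hbub
    have hmin := (hu t).2 b (Multiset.mem_toFinset.mpr hb)
    rw [dist_comm, dist_eq_norm]
    exact hmin.trans_lt (hbub.trans hεsmall)
  /- Step 5: complex points `ψ t` with `ψ t ∘ ι = e t` and `ψ t y = u t`. -/
  have hψ : ∀ t, ∃ ψ : A →ₐ[k] ℂ, (∀ r, ψ (ι r) = e t r) ∧ ψ y = u t := by
    intro t
    let j : (MvPolynomial (Fin d) k)[X] →+* A := (Polynomial.aeval y).toRingHom
    let χ : (MvPolynomial (Fin d) k)[X] →+* ℂ :=
      Polynomial.eval₂RingHom (e t : MvPolynomial (Fin d) k →+* ℂ) (u t)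
    have hjC : ∀ r, j (Polynomial.C r) = ι r := fun r ↦ by
      change Polynomial.aeval y (Polynomial.C r) = ι r
      rw [Polynomial.aeval_C, halg]
      rfl
    have hjX : j Polynomial.X = y := Polynomial.aeval_X y
    have hχC : ∀ r, χ (Polynomial.C r) = e t r := fun r ↦ Polynomial.eval₂_C _ _
    have hχX : χ Polynomial.X = u t := Polynomial.eval₂_X _ _
    have hjint : j.IsIntegral := by
      refine RingHom.IsIntegral.tower_top Polynomial.C j ?_
      have : j.comp Polynomial.C = ι.toRingHom := RingHom.ext fun r ↦ hjC r
      rw [this]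
      exact hιint
    have hker : RingHom.ker j ≤ RingHom.ker χ := by
      intro p hp
      rw [RingHom.mem_ker] at hp ⊢
      obtain ⟨q, rfl⟩ := (minpoly.isIntegrallyClosed_dvd_iff hyint p).mp hp
      rw [map_mul]
      have h0 : χ (minpoly (MvPolynomial (Fin d) k) y) = 0 := by
        change Polynomial.eval₂ (e t : MvPolynomial (Fin d) k →+* ℂ) (u t) G = 0
        rw [← Polynomial.eval_map]
        exact humem t
      rw [h0, zero_mul]
    obtain ⟨Φ, hΦ⟩ := exists_ringHom_comp_eq_of_isIntegral j hjint χ hker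
    have hΦj : ∀ p, Φ (j p) = χ p := fun p ↦ by rw [← hΦ]; rfl
    have hΦι : ∀ r, Φ (ι r) = e t r := fun r ↦ by rw [← hjC, hΦj, hχC]
    refine ⟨{ Φ with commutes' := fun c ↦ ?_ }, hΦι, ?_⟩
    · change Φ (algebraMap k A c) = algebraMap k ℂ c
      rw [IsScalarTower.algebraMap_apply k (MvPolynomial (Fin d) k) A, halg]
      change Φ (ι (algebraMap k _ c)) = _
      rw [hΦι, AlgHom.commutes]
    · change Φ y = u t
      rw [← hjX, hΦj, hχX]
  choose ψ hψι hψy using hψ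
  /- Step 6: a bound `‖ψ t x‖ ≤ B x` for `t` near `t₀`, uniformly in `t` (integrality). -/
  have hbound : ∀ x : A, ∃ B : ℝ, ∀ t ∈ Metric.closedBall t₀ 1, ‖ψ t x‖ ≤ B := by
    intro x
    obtain ⟨H, hHm, hHx⟩ := hιint x
    have hK : IsCompact (Metric.closedBall t₀ (1 : ℝ)) := isCompact_closedBall t₀ 1
    have hCi : ∀ i, ∃ C, ∀ t ∈ Metric.closedBall t₀ 1, ‖e t (H.coeff i)‖ ≤ C := fun i ↦
      hK.exists_bound_of_continuousOn (hcont (H.coeff i)).continuousOn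
    choose C hC using hCi
    refine ⟨(∑ i ∈ Finset.range H.natDegree, |C i|) + 1, fun t ht ↦ ?_⟩
    have hroot : (H.map (e t : MvPolynomial (Fin d) k →+* ℂ)).IsRoot (ψ t x) := by
      have h := congrArg (ψ t : A →+* ℂ) hHx
      have hcomp : (ψ t : A →+* ℂ).comp ι.toRingHom = (e t : MvPolynomial (Fin d) k →+* ℂ) :=
        RingHom.ext fun r ↦ hψι t r
      rw [Polynomial.hom_eval₂, map_zero, hcomp] at h
      rw [IsRoot, Polynomial.eval_map]
      exact h
    refine norm_le_of_isRoot_of_monic (hHm.map _) (Finset.sum_nonneg fun i _ ↦ abs_nonneg _)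
      (fun i hi ↦ ?_) hroot
    rw [hHm.natDegree_map] at hi
    rw [Polynomial.coeff_map]
    exact (hC i t ht).trans ((le_abs_self _).trans
      (Finset.single_le_sum (fun j _ ↦ abs_nonneg (C j)) (Finset.mem_range.mpr hi)))
  choose B hB using hbound
  /- Step 7: `ψ t → ψ₀` pointwise as `t → t₀` within `{c₀ ≠ 0}` (compactness + separation). -/
  haveI hl : (𝓝[{t | e t (ν.coeff 0) ≠ 0}] t₀).NeBot :=
    mem_closure_iff_nhdsWithin_neBot.mp (by rw [hD.closure_eq]; exact Set.mem_univ _)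
  have hlim : Tendsto (fun t ↦ (⇑(ψ t) : A → ℂ)) (𝓝[{t | e t (ν.coeff 0) ≠ 0}] t₀) (𝓝 ⇑ψ₀) := by
    refine (isCompact_univ_pi fun x ↦ ProperSpace.isCompact_closedBall (0 : ℂ) (B x))
      |>.tendsto_nhds_of_unique_mapClusterPt ?_ ?_
    · have hball : Metric.closedBall t₀ 1 ∈ 𝓝[{t | e t (ν.coeff 0) ≠ 0}] t₀ :=
        mem_nhdsWithin_of_mem_nhds (Metric.closedBall_mem_nhds t₀ one_pos)
      filter_upwards [hball] with t ht
      exact fun x _ ↦ by simpa only [Metric.mem_closedBall, dist_zero_right] using hB x t ht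
    · intro φ _ hφ
      -- a cluster point of homomorphisms is a homomorphism
      have hφmem : φ ∈ Set.range (fun ψ : A →ₐ[k] ℂ ↦ (⇑ψ : A → ℂ)) := by
        refine isClosed_iff_clusterPt.mp isClosed_range_coe φ (hφ.clusterPt.mono ?_)
        exact le_principal_iff.mpr (mem_map.mpr (Eventually.of_forall fun t ↦ Set.mem_range_self _))
      obtain ⟨ψ', rfl⟩ := hφmem
      -- its values on `R` and at `y` are those of `ψ₀`
      have hR : ∀ r, ψ' (ι r) = ψ₀ (ι r) := fun r ↦ by
        refine apply_eq_of_mapClusterPt hφ (g := fun φ : A → ℂ ↦ φ (ι r))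
          (continuous_apply _).continuousAt ?_
        have : (fun φ : A → ℂ ↦ φ (ι r)) ∘ (fun t ↦ (⇑(ψ t) : A → ℂ)) = fun t ↦ e t r :=
          funext fun t ↦ hψι t r
        rw [this, ← he₀' r]
        exact ((hcont r).tendsto t₀).mono_left nhdsWithin_le_nhds
      have hY : ψ' y = ψ₀ y := by
        refine apply_eq_of_mapClusterPt hφ (g := fun φ : A → ℂ ↦ φ y)
          (continuous_apply _).continuousAt ?_
        have : (fun φ : A → ℂ ↦ φ y) ∘ (fun t ↦ (⇑(ψ t) : A → ℂ)) = u := funext fun t ↦ hψy t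
        rw [this]
        exact hut.mono_left nhdsWithin_le_nhds
      -- hence it is `ψ₀` (`y` separates the fibre)
      by_contra hne
      exact hy ψ' hR ψ₀ (fun r ↦ rfl) (fun h ↦ hne (congrArg _ h)) hY
  refine mem_closure_of_tendsto hlim ?_
  filter_upwards [self_mem_nhdsWithin] with t ht
  refine ⟨ψ t, fun h ↦ ht ?_, rfl⟩
  rw [← hψι t]
  exact hc₀ (ψ t : A →+* ℂ) h


/-! ### Continuity of polynomial maps in the coefficients' algebra -/

/-- `w ↦ p(w)` is continuous on `Aᵈ` for `p ∈ k[X_σ]` and `A` a topological `k`-algebra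
(`p(w)` is the evaluation of the image of `p` in `A[X_σ]`, Mathlib `MvPolynomial.continuous_eval`).
[folklore] -/
theorem continuous_aeval {k A σ : Type*} [CommSemiring k] [CommSemiring A] [Algebra k A]
    [TopologicalSpace A] [IsTopologicalSemiring A] (p : MvPolynomial σ k) :
    Continuous fun w : σ → A ↦ MvPolynomial.aeval w p := by
  have : (fun w : σ → A ↦ MvPolynomial.aeval w p) =
      fun w ↦ MvPolynomial.eval w (MvPolynomial.map (algebraMap k A) p) := by
    ext w; rw [MvPolynomial.eval_map, MvPolynomial.aeval_def]
  rw [this]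
  exact MvPolynomial.continuous_eval _

/-! ### The density theorem in coordinates -/

/-- **Density in coordinates.** For a prime `𝔭 ⊆ k[X_σ]` (`σ` finite, `k ⊆ ℂ`), `f ∉ 𝔭` and a
complex zero `w₀ ∈ ℂ^σ` of `𝔭`, the complex zeros `w` of `𝔭` with `f(w) ≠ 0` accumulate at
`w₀` (`coe_mem_closure_image_coe_setOf_apply_ne_zero` for `A = k[X_σ]/𝔭`, read on the
coordinates `X_i`). [cite: SGA1, Exp. XII Prop. 2.2] [cite: SerreGAGA1956, §2 n°7 Prop. 5] -/
theorem mem_closure_setOf_le_ker_aeval {k : Type*} [Field k] [Algebra k ℂ] {σ : Type*} [Finite σ]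
    {p : Ideal (MvPolynomial σ k)} [p.IsPrime] {f : MvPolynomial σ k} (hf : f ∉ p) {w₀ : σ → ℂ}
    (hw₀ : p ≤ RingHom.ker (MvPolynomial.aeval w₀ : MvPolynomial σ k →ₐ[k] ℂ)) :
    w₀ ∈ closure {w : σ → ℂ | p ≤ RingHom.ker (MvPolynomial.aeval w : MvPolynomial σ k →ₐ[k] ℂ) ∧
      MvPolynomial.aeval w f ≠ 0} := by
  classical
  haveI : IsDomain (MvPolynomial σ k ⧸ p) := Ideal.Quotient.isDomain p
  have ha : Ideal.Quotient.mk p f ≠ 0 := mt Ideal.Quotient.eq_zero_iff_mem.mp hf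
  let ψ₀ : (MvPolynomial σ k ⧸ p) →ₐ[k] ℂ :=
    Ideal.Quotient.liftₐ p (MvPolynomial.aeval w₀) fun q hq ↦ hw₀ hq
  have hmem := coe_mem_closure_image_coe_setOf_apply_ne_zero ha ψ₀
  have hΛ : Continuous fun (φ : MvPolynomial σ k ⧸ p → ℂ) (i : σ) ↦
      φ (Ideal.Quotient.mk p (MvPolynomial.X i)) :=
    continuous_pi fun i ↦ continuous_apply _
  have h1 := image_closure_subset_closure_image hΛ ⟨_, hmem, rfl⟩
  have hw : (fun i : σ ↦ (⇑ψ₀ : MvPolynomial σ k ⧸ p → ℂ) (Ideal.Quotient.mk p (MvPolynomial.X i))) =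
      w₀ := by
    funext i
    change Ideal.Quotient.liftₐ p (MvPolynomial.aeval w₀) _ (Ideal.Quotient.mk p (MvPolynomial.X i)) =
      w₀ i
    rw [Ideal.Quotient.liftₐ_apply, Ideal.Quotient.lift_mk]
    exact MvPolynomial.aeval_X w₀ i
  dsimp only at h1
  rw [hw] at h1
  refine closure_mono ?_ h1
  rintro _ ⟨_, ⟨ψ, hψ, rfl⟩, rfl⟩
  have hcomp : (MvPolynomial.aeval fun i ↦ ψ (Ideal.Quotient.mk p (MvPolynomial.X i)) :
      MvPolynomial σ k →ₐ[k] ℂ) = ψ.comp (Ideal.Quotient.mkₐ k p) :=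
    MvPolynomial.algHom_ext fun i ↦ by simp
  refine ⟨fun q hq ↦ ?_, ?_⟩
  · rw [RingHom.mem_ker, hcomp, AlgHom.comp_apply, Ideal.Quotient.mkₐ_eq_mk,
      Ideal.Quotient.eq_zero_iff_mem.mpr hq, map_zero]
  · show MvPolynomial.aeval _ f ≠ 0
    rw [hcomp]
    exact hψ

/-! ### Zariski closures of constructible sets are detected through a dense family of points -/

open PrimeSpectrum TopologicalSpace in
/-- **Closure comparison for constructible sets.** Let `Θ : W → Spec R` be continuous (`R`
Noetherian) and suppose that for every prime `𝔭`, every `f ∉ 𝔭` and every `w₀` over `V(𝔭)`,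
`w₀` lies in the closure of `Θ⁻¹(V(𝔭) ∩ D(f))`. Then `closure Θ⁻¹(T) = Θ⁻¹(closure T)` for
every constructible `T ⊆ Spec R`: by the induction principle for constructible sets
(`IsConstructible.induction_of_isTopologicalBasis`) it suffices to treat `T = D(f) ∩ Z`, `Z`
closed, and `Z` is a finite union of irreducible closed sets `V(𝔭)`. This is the formal
skeleton of [SGA1 XII Prop. 2.2] («on est ramené au cas où `T = U` est un ouvert de Zariski …
dense»). [cite: SGA1, Exp. XII Prop. 2.2 (proof)] -/
theorem closure_preimage_eq_of_isConstructible {R W : Type*} [CommRing R] [IsNoetherianRing R]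
    [TopologicalSpace W] {Θ : W → PrimeSpectrum R} (hΘ : Continuous Θ)
    (hdense : ∀ (p : PrimeSpectrum R) (f : R), f ∉ p.asIdeal → ∀ w₀ : W,
      Θ w₀ ∈ zeroLocus (p.asIdeal : Set R) →
        w₀ ∈ closure (Θ ⁻¹' (zeroLocus (p.asIdeal : Set R) ∩ (basicOpen f : Set (PrimeSpectrum R)))))
    {T : Set (PrimeSpectrum R)} (hT : IsConstructible T) :
    closure (Θ ⁻¹' T) = Θ ⁻¹' closure T := by
  refine subset_antisymm
    (closure_minimal (Set.preimage_mono subset_closure) (isClosed_closure.preimage hΘ)) ?_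
  induction T, hT using IsConstructible.induction_of_isTopologicalBasis
    (fun f : R ↦ (basicOpen f : Set (PrimeSpectrum R))) isTopologicalBasis_basic_opens
    (fun f ↦ isCompact_basicOpen f) with
  | union s hs t ht ihs iht =>
    rw [closure_union, Set.preimage_union, Set.preimage_union, closure_union]
    exact Set.union_subset_union ihs iht
  | sdiff f S hS =>
    rw [Set.sdiff_eq_compl_inter, Set.inter_comm]
    set Z : Set (PrimeSpectrum R) := (⋃ j ∈ S, (basicOpen j : Set (PrimeSpectrum R)))ᶜ with hZdef
    have hZ : IsClosed Z :=
      (isOpen_biUnion fun j _ ↦ (basicOpen j).2).isClosed_compl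
    obtain ⟨𝒞, h𝒞fin, h𝒞cl, h𝒞irr, hZeq⟩ :=
      NoetherianSpace.exists_finite_set_isClosed_irreducible hZ
    intro w₀ hw₀
    rw [Set.mem_preimage, hZeq, Set.sUnion_eq_biUnion, Set.inter_iUnion₂,
      h𝒞fin.closure_biUnion, Set.mem_iUnion₂] at hw₀
    obtain ⟨C, hC𝒞, hC⟩ := hw₀
    have hCcl : IsClosed C := h𝒞cl C hC𝒞
    haveI hprime : (vanishingIdeal C).IsPrime :=
      isIrreducible_iff_vanishingIdeal_isPrime.mp (h𝒞irr C hC𝒞)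
    have hCeq : zeroLocus (vanishingIdeal C : Set R) = C := by
      rw [zeroLocus_vanishingIdeal_eq_closure, hCcl.closure_eq]
    have hΘC : Θ w₀ ∈ C := closure_minimal Set.inter_subset_right hCcl hC
    by_cases hf : f ∈ vanishingIdeal C
    · -- `D(f) ∩ C = ∅`
      have hempty : (basicOpen f : Set (PrimeSpectrum R)) ∩ C = ∅ := by
        refine Set.eq_empty_iff_forall_notMem.mpr fun x ⟨hxf, hxC⟩ ↦ ?_
        rw [← hCeq, mem_zeroLocus] at hxC
        exact hxf (hxC hf)
      rw [hempty, closure_empty] at hC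
      exact hC.elim
    · have h := hdense ⟨vanishingIdeal C, hprime⟩ f hf w₀ (by rw [hCeq]; exact hΘC)
      refine closure_mono (Set.preimage_mono ?_) h
      rw [hCeq, Set.inter_comm, hZeq]
      exact Set.inter_subset_inter_right _ (Set.subset_sUnion_of_mem hC𝒞)

end AlgHomClosure

/-! ### Complex points of affine space over `k ⊆ ℂ` -/

open CategoryTheory _root_.AlgebraicGeometry TopologicalSpace IsLocalRing

section ComplexPoints
open Literature.AlgebraicGeometry.Motives (ComplexPoints)
open Literature.AlgebraicGeometry.Motives.ComplexPoints

variable {k : Type} [Field k] [Algebra k ℂ] {σ : Type}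

/-- The chart `w ↦` (point with coordinates `w`), `ℂ^σ → 𝔸^σ_k(ℂ)`, is continuous for the strong
topology, for any subfield `k ⊆ ℂ` (the tree's `ComplexPoints.continuous_affinePoint` is the case
`k = ℂ`, `σ = Fin d`): a sub-basic open `{P ∈ U(ℂ) | s(P) ∈ V}` pulls back to the preimage of
`V` under `w ↦ s(w) = p(w)/g(w)ⁿ`, continuous on the open set `{g ≠ 0}`.
[Serre, GAGA §2 n°5, Lemme 1 & Remarque] [cite: SerreGAGA1956, §2 n°5 Lemme 1] -/
theorem _root_.Literature.AlgebraicGeometry.Motives.ComplexPoints.continuous_affinePoint_of_algebra :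
    Continuous (Literature.AlgebraicGeometry.Motives.AlgPoints.affinePoint k : (σ → ℂ) → ComplexPoints (affineSpaceOver σ k)) := by
  have hopen : ∀ U : (𝔸(σ; Spec (.of k))).Opens,
      IsOpen {w : σ → ℂ | (Literature.AlgebraicGeometry.Motives.AlgPoints.affinePoint k w).pt ∈ U} := by
    intro U
    rw [isOpen_iff_forall_mem_open]
    intro w₀ hw₀
    obtain ⟨_, ⟨_, ⟨g, rfl⟩, rfl⟩, hxg, hgU⟩ :=
      (AlgebraicGeometry.isBasis_basicOpen 𝔸(σ; Spec (.of k))).exists_subset_of_mem_open hw₀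
        U.isOpen
    refine ⟨{w | MvPolynomial.aeval w ((affineSpaceGlobalSectionsIso σ (.of k)).hom g) ≠ 0},
      fun w hw ↦ hgU ?_, isOpen_ne_fun (AlgHomClosure.continuous_aeval _) continuous_const, ?_⟩
    · exact (Literature.AlgebraicGeometry.Motives.AlgPoints.pt_affinePoint_mem_basicOpen_iff w g).mpr hw
    · exact (Literature.AlgebraicGeometry.Motives.AlgPoints.pt_affinePoint_mem_basicOpen_iff w₀ g).mp hxg
  refine continuous_generateFrom_iff.mpr ?_
  rintro _ ⟨U, s, V, hV, rfl⟩
  rw [Literature.AlgebraicGeometry.Motives.AlgPoints.basicSet_eq_setOf]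
  change IsOpen ({w : σ → ℂ | (Literature.AlgebraicGeometry.Motives.AlgPoints.affinePoint k w).pt ∈ U} ∩
    (fun w : σ → ℂ ↦ Literature.AlgebraicGeometry.Motives.AlgPoints.evalOrZero U s (Literature.AlgebraicGeometry.Motives.AlgPoints.affinePoint k w)) ⁻¹' V)
  refine ContinuousOn.isOpen_inter_preimage ?_ (hopen U) hV
  intro w₀ (hw₀ : (Literature.AlgebraicGeometry.Motives.AlgPoints.affinePoint k w₀).pt ∈ U)
  obtain ⟨_, ⟨_, ⟨g, rfl⟩, rfl⟩, hxg, hgU⟩ :=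
    (AlgebraicGeometry.isBasis_basicOpen 𝔸(σ; Spec (.of k))).exists_subset_of_mem_open hw₀
      U.isOpen
  obtain ⟨p, n, hpn⟩ := Literature.AlgebraicGeometry.Motives.AlgPoints.exists_evalOrZero_affinePoint_eq_div (L := ℂ) U s g hgU
  set q : MvPolynomial σ k := (affineSpaceGlobalSectionsIso σ (.of k)).hom g with hq
  have hO : IsOpen {w : σ → ℂ | MvPolynomial.aeval w q ≠ 0} :=
    isOpen_ne_fun (AlgHomClosure.continuous_aeval q) continuous_const
  have hw₀' : MvPolynomial.aeval w₀ q ≠ 0 := (Literature.AlgebraicGeometry.Motives.AlgPoints.pt_affinePoint_mem_basicOpen_iff w₀ g).mp hxg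
  have hc : ContinuousOn (fun w : σ → ℂ ↦ MvPolynomial.aeval w p / MvPolynomial.aeval w q ^ n)
      {w | MvPolynomial.aeval w q ≠ 0} :=
    (AlgHomClosure.continuous_aeval p).continuousOn.div
      ((AlgHomClosure.continuous_aeval q).continuousOn.pow n) fun w hw ↦ pow_ne_zero n hw
  have hc' : ContinuousOn (fun w : σ → ℂ ↦ Literature.AlgebraicGeometry.Motives.AlgPoints.evalOrZero U s (Literature.AlgebraicGeometry.Motives.AlgPoints.affinePoint k w))
      {w : σ → ℂ | MvPolynomial.aeval w q ≠ 0} :=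
    hc.congr fun w hw ↦ hpn w hw
  exact (hc'.continuousAt (hO.mem_nhds hw₀')).continuousWithinAt

/-- **The scheme point under a complex point of `𝔸^σ_k` is the kernel of evaluation**: under
`𝔸^σ_k ≅ Spec k[X_σ]` (Mathlib `AffineSpace.SpecIso`), the point `P.pt` of a complex point `P`
with coordinates `w` is the prime ideal `ker (p ↦ p(w)) ⊆ k[X_σ]`.
[Hartshorne II Ex. 2.7; Mumford, Red Book II §4] [folklore] -/
theorem _root_.Literature.AlgebraicGeometry.Motives.ComplexPoints.specIso_hom_apply_pt (P : ComplexPoints (affineSpaceOver σ k)) :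
    (AffineSpace.SpecIso σ (.of k)).hom P.pt =
      (⟨RingHom.ker (MvPolynomial.aeval (Literature.AlgebraicGeometry.Motives.AlgPoints.affineCoords P) : MvPolynomial σ k →ₐ[k] ℂ),
        RingHom.ker_isPrime _⟩ : PrimeSpectrum (MvPolynomial σ k)) := by
  conv_lhs => rw [← Literature.AlgebraicGeometry.Motives.AlgPoints.affinePoint_affineCoords P]
  change (AffineSpace.SpecIso σ (.of k)).hom.base
      ((Spec.map (CommRingCat.ofHom
          (MvPolynomial.aeval (Literature.AlgebraicGeometry.Motives.AlgPoints.affineCoords P)).toRingHom) ≫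
        (AffineSpace.SpecIso σ (.of k)).inv).base (closedPoint ℂ)) = _
  rw [← ConcreteCategory.comp_apply, ← Scheme.Hom.comp_base, Category.assoc, Iso.inv_hom_id,
    Category.comp_id]
  refine PrimeSpectrum.ext ?_
  change Ideal.comap (MvPolynomial.aeval (Literature.AlgebraicGeometry.Motives.AlgPoints.affineCoords P)).toRingHom
    (IsLocalRing.maximalIdeal ℂ) = RingHom.ker _
  rw [(IsLocalRing.isField_iff_maximalIdeal_eq).mp (Field.toIsField ℂ),
    ← RingHom.ker_eq_comap_bot]
  rfl

/-- **Discharge of the named fact `closure_setOf_pt_mem` for affine space**: for `T ⊆ 𝔸^σ_k`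
locally constructible (`σ` finite, `k ⊆ ℂ` any subfield),
`closure {P ∈ 𝔸^σ_k(ℂ) | P.pt ∈ T} = {P | P.pt ∈ closure T}` (SGA1 XII Prop. 2.2 for `X = 𝔸^σ`).
Proof: transport along `𝔸^σ_k(ℂ) ≃ₜ ℂ^σ` and `𝔸^σ_k ≅ Spec k[X_σ]` to
`AlgHomClosure.closure_preimage_eq_of_isConstructible` for `Θ : w ↦ ker (p ↦ p(w))`, whose
hypothesis is the density theorem `AlgHomClosure.mem_closure_setOf_le_ker_aeval`.
[cite: SGA1, Exp. XII Prop. 2.2] [cite: SerreGAGA1956, §2 n°7 Prop. 5] -/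
theorem _root_.Literature.AlgebraicGeometry.Motives.ComplexPoints.closure_setOf_pt_mem_affineSpace [Finite σ] :
    closure_setOf_pt_mem (affineSpaceOver σ k) := by
  intro _ T hT
  classical
  let h : ↥(affineSpaceOver σ k).left ≃ₜ PrimeSpectrum (MvPolynomial σ k) :=
    Scheme.homeoOfIso (AffineSpace.SpecIso σ (.of k))
  let Θ : (σ → ℂ) → PrimeSpectrum (MvPolynomial σ k) := fun w ↦
    ⟨RingHom.ker (MvPolynomial.aeval w : MvPolynomial σ k →ₐ[k] ℂ), RingHom.ker_isPrime _⟩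
  let Φ : ComplexPoints (affineSpaceOver σ k) ≃ₜ (σ → ℂ) :=
    { (Literature.AlgebraicGeometry.Motives.AlgPoints.affinePointEquiv k ℂ σ).symm with
      continuous_toFun := Literature.AlgebraicGeometry.Motives.AlgPoints.continuous_affineCoords
      continuous_invFun := continuous_affinePoint_of_algebra }
  have hΘΦ : ∀ P : ComplexPoints (affineSpaceOver σ k), h P.pt = Θ (Φ P) :=
    specIso_hom_apply_pt
  have hΘcont : Continuous Θ := by
    refine PrimeSpectrum.isTopologicalBasis_basic_opens.continuous_iff.mpr ?_
    rintro _ ⟨f, rfl⟩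
    have hset : Θ ⁻¹' (PrimeSpectrum.basicOpen f : Set (PrimeSpectrum (MvPolynomial σ k))) =
        {w | MvPolynomial.aeval w f ≠ 0} := by
      ext w
      simp [Θ, RingHom.mem_ker]
    rw [hset]
    exact isOpen_ne_fun (AlgHomClosure.continuous_aeval f) continuous_const
  have hdense : ∀ (p : PrimeSpectrum (MvPolynomial σ k)) (f : MvPolynomial σ k), f ∉ p.asIdeal →
      ∀ w₀ : σ → ℂ, Θ w₀ ∈ PrimeSpectrum.zeroLocus (p.asIdeal : Set (MvPolynomial σ k)) →
        w₀ ∈ closure (Θ ⁻¹' (PrimeSpectrum.zeroLocus (p.asIdeal : Set (MvPolynomial σ k)) ∩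
          (PrimeSpectrum.basicOpen f : Set (PrimeSpectrum (MvPolynomial σ k))))) := by
    intro p f hf w₀ hw₀
    have hw₀' : p.asIdeal ≤ RingHom.ker (MvPolynomial.aeval w₀ : MvPolynomial σ k →ₐ[k] ℂ) := by
      simpa [Θ, PrimeSpectrum.mem_zeroLocus, SetLike.coe_subset_coe] using hw₀
    have hset : Θ ⁻¹' (PrimeSpectrum.zeroLocus (p.asIdeal : Set (MvPolynomial σ k)) ∩
        (PrimeSpectrum.basicOpen f : Set (PrimeSpectrum (MvPolynomial σ k)))) =
        {w : σ → ℂ | p.asIdeal ≤ RingHom.ker (MvPolynomial.aeval w : MvPolynomial σ k →ₐ[k] ℂ) ∧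
          MvPolynomial.aeval w f ≠ 0} := by
      ext w
      simp [Θ, PrimeSpectrum.mem_zeroLocus, RingHom.mem_ker, SetLike.coe_subset_coe]
    rw [hset]
    exact AlgHomClosure.mem_closure_setOf_le_ker_aeval hf hw₀'
  have hT' : IsConstructible (h.symm ⁻¹' T) :=
    (hT.preimage_of_isOpenEmbedding h.symm.isOpenEmbedding).isConstructible
  have hmodel := AlgHomClosure.closure_preimage_eq_of_isConstructible hΘcont hdense hT'
  have h1 : {P : ComplexPoints (affineSpaceOver σ k) | P.pt ∈ T} = Φ ⁻¹' (Θ ⁻¹' (h.symm ⁻¹' T)) := by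
    ext P
    simp only [Set.mem_setOf_eq, Set.mem_preimage]
    rw [← hΘΦ, Homeomorph.symm_apply_apply]
  have h2 : {P : ComplexPoints (affineSpaceOver σ k) | P.pt ∈ closure T} =
      Φ ⁻¹' (Θ ⁻¹' closure (h.symm ⁻¹' T)) := by
    ext P
    simp only [Set.mem_setOf_eq, Set.mem_preimage]
    rw [← Homeomorph.preimage_closure, Set.mem_preimage, ← hΘΦ, Homeomorph.symm_apply_apply]
  rw [h1, h2, ← Homeomorph.preimage_closure, hmodel]

/-! ### The named fact `compactSpace_iff_isProper` -/

/-- **`X(ℂ)` is compact iff `X` is proper** — discharge of the named fact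
`Literature.ComplexPoints.compactSpace_iff_isProper X` of `Analytification.lean`: for `X` separated and
locally of finite type over a subfield `k ⊆ ℂ`, the space of complex points `X(ℂ)` with its strong
topology is compact iff `X → Spec k` is proper. «Pour qu'une variété algébrique `X` soit complète,
il faut et il suffit qu'elle soit compacte» (Serre, GAGA §2 n°7 Prop. 6; SGA1 XII Prop. 3.2 (v)
for schemes locally of finite type). Assembled by `compactSpace_iff_isProper_of` (the SGA1
argument, `AnalytificationProper.lean`) from the four discharged facts
`compactSpace_algPoints_of_isProper_holds` (⇐, valuative criterion),
`AlgPoints.isHomeomorph_prodEquiv_holds` (`(X × 𝔸ⁿ)(ℂ) = X(ℂ) × 𝔸ⁿ(ℂ)`),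
`closure_setOf_pt_mem_affineSpace` (SGA1 XII Prop. 2.2 for `𝔸ⁿ`, this file) and
`AlgGeom.universallyClosed_iff_isClosedMap_affineSpaceMap_holds` (Stacks 05JX).
[cite: SerreGAGA1956, §2 n°7 Prop. 6] [cite: SGA1, Exp. XII Prop. 3.2 (v)] -/
theorem _root_.Literature.AlgebraicGeometry.Motives.ComplexPoints.compactSpace_iff_isProper_holds {k : Type} [Field k] [Algebra k ℂ] (X : Literature.AlgebraicGeometry.Motives.SchemeOver k) :
    compactSpace_iff_isProper X :=
  compactSpace_iff_isProper_of X (Literature.AlgebraicGeometry.Motives.compactSpace_algPoints_of_isProper_holds X ℂ)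
    (fun _ _ ↦ Literature.AlgebraicGeometry.Motives.AlgPoints.isHomeomorph_prodEquiv_holds) (fun _ _ ↦ closure_setOf_pt_mem_affineSpace)
    Literature.AlgebraicGeometry.Morphisms.universallyClosed_iff_isClosedMap_affineSpaceMap_holds

end ComplexPoints

end Literature.NumberTheory.Transcendental
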